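import Summits.ValiantsHypothesis.ValiantsHypothesis.Theorems.LacunarySymmetroidMatrixDescartesPivotResolventCurvature
import Summits.ValiantsHypothesis.ValiantsHypothesis.Theorems.LacunarySymmetroidMatrixDescartesPivotRankOneResolventPairForm

/-!
# `MatrixDescartes` census — rank-one `(2,4)₁`: `Z₊(det F) ≤ Z₊(𝒦) + 4` by the CURVATURE REDUCTION
# (four rank-one letters one-sided for the pivot form, ANY pivot position; `𝒦 = τ_eπ_ee − τ_eeπ_e` an explicit 16-nomial)

HONEST FRAMING.  Object-search cell `pub-symmetroid`, seat `val-sym-mdr-p1` (generation 20); helper file `--supports` the crux item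
stmt-ValiantsHypothesis-18050 (`Theses.LacunarySymmetroid.MatrixDescartes`, OPEN, on HOLD) with NO closure claim.  The four-letter
INSTANCE of the curvature reduction `…PivotResolventCurvature` (`card_posRoots_le_curvature_count`:
`Z₊(f) ≤ Z₊(τ_e) + Z₊(𝒦) + Z₊(E) + 2`): for four rank-one letters that are ONE-SIDED for the pivot form
(`m(J,vₖ) = J₀₀vₖ₁² − 2J₀₁vₖ₀vₖ₁ + J₁₁vₖ₀² ≤ 0` for all `k` — the lineage's «all core» class; `J ↦ −J` mirrors the other sign) the two
side factors are Euler derivatives of ONE-SIGNED fewnomials,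
`τ_e(x) = ∑ₖ (dₖ − e)·wₖmₖ·x^{dₖ}` and `E(x) = ∑_{k,l} ½(dₖ + d_l − 2e)·wₖw_l(mₖm_l + 2δD_{kl}²)·x^{dₖ+d_l}` (`δ = −det J > 0`,
`D_{kl} = det(vₖ, v_l)`), hence have AT MOST ONE positive root each, for EVERY pivot position `e` (§3,
`card_posRoots_le_one_of_eulerForm`: an elementary one-sign-change Descartes count — for two roots `0 < x < y`,
`0 = p(y) − (y/x)^a p(x)` is a sum of non-negative terms).  MAIN THEOREM (§4, `rankOne_four_card_posRoots_le_curvature_add_four`):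
**`Z₊(det F) ≤ Z₊(𝒦) + 4`** under the generic side conditions of the reduction (resolvent discriminant positive on `(0,∞)`, `Φ` avoids
the positive roots of `τ_e`, `τ_e·𝒦·E ≠ 0`).  READING for the last open piece of «rank-one (2,4)₁ = 8» (chamber (C) of the `1|3` split,
Descartes-with-parity `9`, `…PivotRankOneReductionOneThree`): «(C) ≤ 8» ⟸ «the curvature Wronskian `𝒦` (16 exponents `dᵢ + dⱼ + dₖ`,
coefficients `σᵢⱼuᵢuⱼuₖ(βᵢ+βⱼ)βₖ(βᵢ+βⱼ−βₖ)` in hyperbolic normal form) has at most FOUR positive roots on (C)» — LOCATED by the seat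
(random + adversarial census on the whole `1|3` split: `Z₊(𝒦) ∈ {0, 2, 4}`), where Descartes' rule allows `6–12`; NOT proved here.
Nothing here bears on `MatrixDescartes` in its window, on `DoorA26` / `DoorA34`, registers / credences, or `VP ≠ VNP`.

[folklore] Descartes' rule with one sign change (elementary form); the lineage's `…PivotRankOneResolventPairForm` (moment four-nomials,
`eval_det_resolvent_form`, `pairDet_nonneg`) and `…PivotResolventCurvature`.  No definitions, no named facts.
-/

-- `Summit.ValiantsHypothesis.ValiantsHypothesis.…` repeats a component by the D-0017 layout
-- (single-conjunct summit), which the `dupNamespace` linter flags; the name is mandated.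
set_option linter.dupNamespace false

namespace Summit.ValiantsHypothesis.ValiantsHypothesis.Theorems.LacunarySymmetroidMatrixDescartes.Pivot.Resolvent

open Polynomial Finset Set Matrix
open scoped BigOperators

/-! ## 3 (continued numbering of `…PivotResolventCurvature`). Euler derivatives of one-signed fewnomials have at most one positive root -/

/-- **ONE-SIGN EULER LEMMA.**  If on `(0, ∞)` a nonzero polynomial `p` agrees with `∑_{i∈s} (nᵢ − a)·cᵢ·x^{nᵢ}` with all `cᵢ ≥ 0`
(the weight-`a` Euler derivative `x·q′ − a·q` of a posynomial `q = ∑ cᵢx^{nᵢ}`), then `p` has AT MOST ONE distinct positive root —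
whatever the position of `a` among the exponents.  Proof without calculus: for two roots `0 < x < y`, `r = y/x > 1`,
`0 = p(y) − r^a p(x) = ∑ (nᵢ − a)cᵢx^{nᵢ}(r^{nᵢ} − r^a)` is a sum of non-negative terms, so every term vanishes, so `cᵢ = 0` or `nᵢ = a`
for all `i`, so `p ≡ 0` on `(0, ∞)`, so `p = 0`. [folklore: Descartes' rule with one sign change, elementary form] -/
theorem card_posRoots_le_one_of_eulerForm {ι : Type*} (s : Finset ι) (n : ι → ℕ) (c : ι → ℝ) (a : ℕ) (p : ℝ[X])
    (hc : ∀ i ∈ s, 0 ≤ c i) (hp : ∀ x : ℝ, 0 < x → p.eval x = ∑ i ∈ s, (((n i : ℕ) : ℝ) - a) * c i * x ^ (n i))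
    (hp0 : p ≠ 0) :
    (p.roots.toFinset.filter (fun t => 0 < t)).card ≤ 1 := by
  classical
  -- two distinct positive roots force every term to be trivial
  have key : ∀ x y : ℝ, 0 < x → x < y → p.eval x = 0 → p.eval y = 0 → ∀ i ∈ s, c i = 0 ∨ n i = a := by
    intro x y hx hxy hpx hpy i hi
    set r : ℝ := y / x with hr
    have hr1 : 1 < r := (one_lt_div hx).2 hxy
    have hr0 : 0 < r := by linarith
    have hyx : y = x * r := by rw [hr]; field_simp
    have hy : 0 < y := by linarith
    have hpy' : ∑ j ∈ s, (((n j : ℕ) : ℝ) - a) * c j * x ^ (n j) * r ^ (n j) = 0 := by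
      rw [← hpy, hp y hy, hyx]
      refine Finset.sum_congr rfl fun j _ => ?_
      rw [mul_pow]; ring
    have hpx' : ∑ j ∈ s, (((n j : ℕ) : ℝ) - a) * c j * x ^ (n j) * r ^ a = 0 := by
      rw [← Finset.sum_mul, ← hp x hx, hpx, zero_mul]
    have hsum : ∑ j ∈ s, (((n j : ℕ) : ℝ) - a) * c j * x ^ (n j) * (r ^ (n j) - r ^ a) = 0 := by
      have : ∑ j ∈ s, (((n j : ℕ) : ℝ) - a) * c j * x ^ (n j) * (r ^ (n j) - r ^ a)
          = ∑ j ∈ s, (((n j : ℕ) : ℝ) - a) * c j * x ^ (n j) * r ^ (n j)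
            - ∑ j ∈ s, (((n j : ℕ) : ℝ) - a) * c j * x ^ (n j) * r ^ a := by
        rw [← Finset.sum_sub_distrib]
        refine Finset.sum_congr rfl fun j _ => ?_
        ring
      rw [this, hpy', hpx', sub_zero]
    have hnonneg : ∀ j ∈ s, 0 ≤ (((n j : ℕ) : ℝ) - a) * c j * x ^ (n j) * (r ^ (n j) - r ^ a) := by
      intro j hj
      have hcx : 0 ≤ c j * x ^ (n j) := mul_nonneg (hc j hj) (pow_pos hx _).le
      have hmono : 0 ≤ (((n j : ℕ) : ℝ) - a) * (r ^ (n j) - r ^ a) := by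
        rcases le_or_gt a (n j) with h | h
        · have h1 : (0 : ℝ) ≤ ((n j : ℕ) : ℝ) - a := by
            have : (a : ℝ) ≤ (n j : ℝ) := by exact_mod_cast h
            linarith
          have h2 : (0 : ℝ) ≤ r ^ (n j) - r ^ a := by
            have := pow_le_pow_right₀ hr1.le h
            linarith
          exact mul_nonneg h1 h2
        · have h1 : ((n j : ℕ) : ℝ) - a ≤ 0 := by
            have : (n j : ℝ) ≤ (a : ℝ) := by exact_mod_cast h.le
            linarith
          have h2 : r ^ (n j) - r ^ a ≤ 0 := by
            have := pow_le_pow_right₀ hr1.le h.le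
            linarith
          exact mul_nonneg_of_nonpos_of_nonpos h1 h2
      have : (((n j : ℕ) : ℝ) - a) * c j * x ^ (n j) * (r ^ (n j) - r ^ a)
          = (c j * x ^ (n j)) * ((((n j : ℕ) : ℝ) - a) * (r ^ (n j) - r ^ a)) := by ring
      rw [this]
      exact mul_nonneg hcx hmono
    have hterm := (Finset.sum_eq_zero_iff_of_nonneg hnonneg).1 hsum i hi
    -- read off: c i = 0 or n i = a
    by_contra hcon
    push Not at hcon
    obtain ⟨hci, hni⟩ := hcon
    have hcpos : 0 < c i := lt_of_le_of_ne (hc i hi) (Ne.symm hci)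
    have hna : (((n i : ℕ) : ℝ) - a) ≠ 0 := by
      intro h
      apply hni
      have : ((n i : ℕ) : ℝ) = (a : ℝ) := by linarith
      exact_mod_cast this
    have hrpow : r ^ (n i) - r ^ a ≠ 0 := by
      intro h
      apply hni
      exact pow_right_injective₀ hr0 hr1.ne' (sub_eq_zero.1 h)
    have hxpow : (x ^ (n i)) ≠ 0 := (pow_pos hx _).ne'
    have : (((n i : ℕ) : ℝ) - a) * c i * x ^ (n i) * (r ^ (n i) - r ^ a) ≠ 0 :=
      mul_ne_zero (mul_ne_zero (mul_ne_zero hna hcpos.ne') hxpow) hrpow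
    exact this hterm
  -- if every term is trivial then `p` vanishes on `(0, ∞)`, hence `p = 0`
  have vanish : (∀ i ∈ s, c i = 0 ∨ n i = a) → p = 0 := by
    intro h
    apply Polynomial.eq_zero_of_infinite_isRoot
    apply Set.Infinite.mono (s := Set.Ioi (0 : ℝ))
    · intro z hz
      rw [Set.mem_setOf_eq, IsRoot.def, hp z hz]
      refine Finset.sum_eq_zero fun i hi => ?_
      rcases h i hi with h0 | h0
      · rw [h0]; ring
      · rw [h0]; ring
    · exact Set.Ioi_infinite 0
  rw [Finset.card_le_one]
  intro x hx y hy
  simp only [Finset.mem_filter, Multiset.mem_toFinset, mem_roots hp0, IsRoot.def] at hx hy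
  by_contra hxy
  rcases lt_or_gt_of_ne hxy with h | h
  · exact hp0 (vanish (key x y hx.2 h hx.1 hy.1))
  · exact hp0 (vanish (key y x hy.2 h hy.1 hx.1))

/-! ## 4. Four rank-one letters: `Z₊(det F) ≤ Z₊(𝒦) + 4` (any pivot position, all letters on one side of the pivot form) -/

set_option maxHeartbeats 400000 in
/-- **CURVATURE REDUCTION FOR FOUR RANK-ONE LETTERS.**  `F = X^e J + ∑ₖ wₖ X^{dₖ} vₖvₖᵀ` on `Fin 2`, `J` symmetric with `det J < 0`,
weights `wₖ ≥ 0`, all four letters ONE-SIDED for the pivot form: `m(J, vₖ) = J₀₀vₖ₁² − 2J₀₁vₖ₀vₖ₁ + J₁₁vₖ₀² ≤ 0` for every `k` (the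
«all core» class of the lineage; the other sign class is its mirror `J ↦ −J`).  With the moment polynomials `𝔄, 𝔘, ℭ`, `τ = J₀₀ℭ − 2J₀₁𝔘 + J₁₁𝔄`,
`π = 𝔄ℭ − 𝔘²`, the critical polynomial `Φ`, the curvature Wronskian `𝒦 = τ_eπ_ee − τ_eeπ_e` and `E = 2δπ_e + ττ_e`
(`δ = J₀₁² − J₀₀J₁₁ > 0`): if the resolvent discriminant is positive on `(0,∞)`, `Φ` avoids the positive roots of `τ_e`, and `τ_e·𝒦·E ≠ 0`,
then **`Z₊(det F) ≤ Z₊(𝒦) + 4`** — because `τ_e(x) = ∑ₖ (dₖ − e)wₖmₖx^{dₖ}` and `E(x) = ∑_{k,l} ½(dₖ + d_l − 2e)wₖw_l(mₖm_l + 2δD_{kl}²)x^{dₖ+d_l}`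
are Euler derivatives of ONE-SIGNED fewnomials (`card_posRoots_le_one_of_eulerForm`: at most one positive root each, for EVERY pivot
position `e`).  LOCATED (seat memo): `Z₊(𝒦) ≤ 4` on the whole `1|3` split, where Descartes allows `6–12`; «(C) ≤ 8» ⟸ «Z₊(𝒦) ≤ 4 on (C)»,
NOT proved here. [this file + `card_posRoots_le_curvature_count`] -/
theorem rankOne_four_card_posRoots_le_curvature_add_four (e d₀ d₁ d₂ d₃ : ℕ) (J : Matrix (Fin 2) (Fin 2) ℝ) (hJ : J 1 0 = J 0 1)
    (hdJ : J 0 0 * J 1 1 - J 0 1 ^ 2 < 0) (v₀ v₁ v₂ v₃ : Fin 2 → ℝ) (w₀ w₁ w₂ w₃ : ℝ) (hw₀ : 0 ≤ w₀) (hw₁ : 0 ≤ w₁) (hw₂ : 0 ≤ w₂)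
    (hw₃ : 0 ≤ w₃)
    (hm₀ : J 0 0 * v₀ 1 ^ 2 - 2 * J 0 1 * (v₀ 0 * v₀ 1) + J 1 1 * v₀ 0 ^ 2 ≤ 0)
    (hm₁ : J 0 0 * v₁ 1 ^ 2 - 2 * J 0 1 * (v₁ 0 * v₁ 1) + J 1 1 * v₁ 0 ^ 2 ≤ 0)
    (hm₂ : J 0 0 * v₂ 1 ^ 2 - 2 * J 0 1 * (v₂ 0 * v₂ 1) + J 1 1 * v₂ 0 ^ 2 ≤ 0)
    (hm₃ : J 0 0 * v₃ 1 ^ 2 - 2 * J 0 1 * (v₃ 0 * v₃ 1) + J 1 1 * v₃ 0 ^ 2 ≤ 0)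
    (𝔄 𝔘 ℭ τ π τe πe τee πee Φ 𝒦 E : ℝ[X])
    (h𝔄 : 𝔄 = Polynomial.C (w₀ * v₀ 0 ^ 2) * X ^ d₀ + Polynomial.C (w₁ * v₁ 0 ^ 2) * X ^ d₁ + Polynomial.C (w₂ * v₂ 0 ^ 2) * X ^ d₂
      + Polynomial.C (w₃ * v₃ 0 ^ 2) * X ^ d₃)
    (h𝔘 : 𝔘 = Polynomial.C (w₀ * (v₀ 0 * v₀ 1)) * X ^ d₀ + Polynomial.C (w₁ * (v₁ 0 * v₁ 1)) * X ^ d₁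
      + Polynomial.C (w₂ * (v₂ 0 * v₂ 1)) * X ^ d₂ + Polynomial.C (w₃ * (v₃ 0 * v₃ 1)) * X ^ d₃)
    (hℭ : ℭ = Polynomial.C (w₀ * v₀ 1 ^ 2) * X ^ d₀ + Polynomial.C (w₁ * v₁ 1 ^ 2) * X ^ d₁ + Polynomial.C (w₂ * v₂ 1 ^ 2) * X ^ d₂
      + Polynomial.C (w₃ * v₃ 1 ^ 2) * X ^ d₃)
    (hτ : τ = Polynomial.C (J 0 0) * ℭ - Polynomial.C (2 * J 0 1) * 𝔘 + Polynomial.C (J 1 1) * 𝔄)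
    (hπ : π = 𝔄 * ℭ - 𝔘 ^ 2)
    (hτe : τe = X * derivative τ - Polynomial.C (e : ℝ) * τ) (hπe : πe = X * derivative π - Polynomial.C (2 * (e : ℝ)) * π)
    (hτee : τee = X * derivative τe - Polynomial.C (e : ℝ) * τe) (hπee : πee = X * derivative πe - Polynomial.C (2 * (e : ℝ)) * πe)
    (hΦ : Φ = Polynomial.C (J 0 1 ^ 2 - J 0 0 * J 1 1) * πe ^ 2 + τ * τe * πe - π * τe ^ 2) (h𝒦 : 𝒦 = τe * πee - τee * πe)
    (hE : E = Polynomial.C (2 * (J 0 1 ^ 2 - J 0 0 * J 1 1)) * πe + τ * τe)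
    (hdisc : ∀ x, 0 < x → 0 < (τ.eval x) ^ 2 + 4 * (J 0 1 ^ 2 - J 0 0 * J 1 1) * π.eval x)
    (hgen : ∀ x, 0 < x → τe.eval x = 0 → Φ.eval x ≠ 0) (hne : τe * 𝒦 * E ≠ 0) :
    ((Matrix.det (((X : ℝ[X]) ^ e) • J.map Polynomial.C
        + (Polynomial.C w₀ * X ^ d₀) • (vecMulVec v₀ v₀).map Polynomial.C
        + (Polynomial.C w₁ * X ^ d₁) • (vecMulVec v₁ v₁).map Polynomial.C
        + (Polynomial.C w₂ * X ^ d₂) • (vecMulVec v₂ v₂).map Polynomial.C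
        + (Polynomial.C w₃ * X ^ d₃) • (vecMulVec v₃ v₃).map Polynomial.C)).roots.toFinset.filter (fun t => 0 < t)).card
      ≤ (𝒦.roots.toFinset.filter (fun t => 0 < t)).card + 4 := by
  set δ : ℝ := J 0 1 ^ 2 - J 0 0 * J 1 1 with hδ
  have hδpos : 0 < δ := by rw [hδ]; linarith
  set m₀ : ℝ := J 0 0 * v₀ 1 ^ 2 - 2 * J 0 1 * (v₀ 0 * v₀ 1) + J 1 1 * v₀ 0 ^ 2 with hm₀d
  set m₁ : ℝ := J 0 0 * v₁ 1 ^ 2 - 2 * J 0 1 * (v₁ 0 * v₁ 1) + J 1 1 * v₁ 0 ^ 2 with hm₁d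
  set m₂ : ℝ := J 0 0 * v₂ 1 ^ 2 - 2 * J 0 1 * (v₂ 0 * v₂ 1) + J 1 1 * v₂ 0 ^ 2 with hm₂d
  set m₃ : ℝ := J 0 0 * v₃ 1 ^ 2 - 2 * J 0 1 * (v₃ 0 * v₃ 1) + J 1 1 * v₃ 0 ^ 2 with hm₃d
  -- evaluations of τ, x·τ′, π, x·π′
  have hτeval : ∀ x, τ.eval x = w₀ * m₀ * x ^ d₀ + w₁ * m₁ * x ^ d₁ + w₂ * m₂ * x ^ d₂ + w₃ * m₃ * x ^ d₃ := by
    intro x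
    rw [hτ]
    simp only [eval_add, eval_sub, eval_mul, eval_C]
    rw [h𝔄, h𝔘, hℭ, eval_fourNomial, eval_fourNomial, eval_fourNomial]
    ring
  have hτ'eval : ∀ x, x * τ.derivative.eval x
      = (d₀ : ℝ) * (w₀ * m₀) * x ^ d₀ + (d₁ : ℝ) * (w₁ * m₁) * x ^ d₁ + (d₂ : ℝ) * (w₂ * m₂) * x ^ d₂ + (d₃ : ℝ) * (w₃ * m₃) * x ^ d₃ := by
    intro x
    rw [hτ]
    simp only [derivative_add, derivative_sub, derivative_mul, derivative_C, zero_mul, zero_add, eval_add, eval_sub, eval_mul,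
      eval_C, mul_add, mul_sub]
    rw [h𝔄, h𝔘, hℭ]
    have hA := x_mul_eval_derivative_fourNomial (w₀ * v₀ 0 ^ 2) (w₁ * v₁ 0 ^ 2) (w₂ * v₂ 0 ^ 2) (w₃ * v₃ 0 ^ 2) x d₀ d₁ d₂ d₃
    have hU := x_mul_eval_derivative_fourNomial (w₀ * (v₀ 0 * v₀ 1)) (w₁ * (v₁ 0 * v₁ 1)) (w₂ * (v₂ 0 * v₂ 1)) (w₃ * (v₃ 0 * v₃ 1)) x
      d₀ d₁ d₂ d₃
    have hC := x_mul_eval_derivative_fourNomial (w₀ * v₀ 1 ^ 2) (w₁ * v₁ 1 ^ 2) (w₂ * v₂ 1 ^ 2) (w₃ * v₃ 1 ^ 2) x d₀ d₁ d₂ d₃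
    rw [hm₀d, hm₁d, hm₂d, hm₃d]
    linear_combination (J 0 0) * hC - (2 * J 0 1) * hU + (J 1 1) * hA
  -- (a) Z₊(τe) ≤ 1 : τe(x) = ∑ (dₖ − e)(wₖmₖ)x^{dₖ}, i.e. −τe is the Euler derivative of the posynomial ∑ (−wₖmₖ)x^{dₖ}
  have hτe_le : (τe.roots.toFinset.filter (fun t => 0 < t)).card ≤ 1 := by
    have hτe0 : τe ≠ 0 := fun h => hne (by rw [h, zero_mul, zero_mul])
    have hneg : ((-τe).roots.toFinset.filter (fun t => 0 < t)).card ≤ 1 := by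
      refine card_posRoots_le_one_of_eulerForm (Finset.univ : Finset (Fin 4)) ![d₀, d₁, d₂, d₃]
        ![-(w₀ * m₀), -(w₁ * m₁), -(w₂ * m₂), -(w₃ * m₃)] e (-τe) ?_ ?_ (neg_ne_zero.2 hτe0)
      · intro i _
        fin_cases i <;> simp <;> nlinarith
      · intro x hx
        rw [eval_neg, hτe, eval_sub, eval_mul, eval_mul, eval_X, eval_C, hτ'eval, hτeval, Fin.sum_univ_four]
        simp only [Matrix.cons_val_zero, Matrix.cons_val_one, Matrix.head_cons, Matrix.cons_val_two, Matrix.tail_cons,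
          Matrix.cons_val_three]
        ring
    rwa [roots_neg] at hneg
  -- (b) Z₊(E) ≤ 1 : E(x) = ∑_{k,l} ½(dₖ + d_l − 2e)·wₖw_l(mₖm_l + 2δD_{kl}²)·x^{dₖ+d_l}
  have hE_le : (E.roots.toFinset.filter (fun t => 0 < t)).card ≤ 1 := by
    have hE0 : E ≠ 0 := fun h => hne (by rw [h, mul_zero])
    have hπeval : ∀ x, π.eval x = (w₀ * x ^ d₀ * v₀ 0 ^ 2 + w₁ * x ^ d₁ * v₁ 0 ^ 2 + w₂ * x ^ d₂ * v₂ 0 ^ 2 + w₃ * x ^ d₃ * v₃ 0 ^ 2)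
        * (w₀ * x ^ d₀ * v₀ 1 ^ 2 + w₁ * x ^ d₁ * v₁ 1 ^ 2 + w₂ * x ^ d₂ * v₂ 1 ^ 2 + w₃ * x ^ d₃ * v₃ 1 ^ 2)
        - (w₀ * x ^ d₀ * (v₀ 0 * v₀ 1) + w₁ * x ^ d₁ * (v₁ 0 * v₁ 1) + w₂ * x ^ d₂ * (v₂ 0 * v₂ 1) + w₃ * x ^ d₃ * (v₃ 0 * v₃ 1)) ^ 2 := by
      intro x
      rw [hπ, eval_sub, eval_mul, eval_pow, h𝔄, h𝔘, hℭ, eval_fourNomial, eval_fourNomial, eval_fourNomial]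
      ring
    have hπ'eval : ∀ x, x * π.derivative.eval x
        = ((d₀ : ℝ) * (w₀ * v₀ 0 ^ 2) * x ^ d₀ + (d₁ : ℝ) * (w₁ * v₁ 0 ^ 2) * x ^ d₁ + (d₂ : ℝ) * (w₂ * v₂ 0 ^ 2) * x ^ d₂
              + (d₃ : ℝ) * (w₃ * v₃ 0 ^ 2) * x ^ d₃)
            * (w₀ * v₀ 1 ^ 2 * x ^ d₀ + w₁ * v₁ 1 ^ 2 * x ^ d₁ + w₂ * v₂ 1 ^ 2 * x ^ d₂ + w₃ * v₃ 1 ^ 2 * x ^ d₃)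
          + (w₀ * v₀ 0 ^ 2 * x ^ d₀ + w₁ * v₁ 0 ^ 2 * x ^ d₁ + w₂ * v₂ 0 ^ 2 * x ^ d₂ + w₃ * v₃ 0 ^ 2 * x ^ d₃)
            * ((d₀ : ℝ) * (w₀ * v₀ 1 ^ 2) * x ^ d₀ + (d₁ : ℝ) * (w₁ * v₁ 1 ^ 2) * x ^ d₁ + (d₂ : ℝ) * (w₂ * v₂ 1 ^ 2) * x ^ d₂
              + (d₃ : ℝ) * (w₃ * v₃ 1 ^ 2) * x ^ d₃)
          - 2 * (w₀ * (v₀ 0 * v₀ 1) * x ^ d₀ + w₁ * (v₁ 0 * v₁ 1) * x ^ d₁ + w₂ * (v₂ 0 * v₂ 1) * x ^ d₂ + w₃ * (v₃ 0 * v₃ 1) * x ^ d₃)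
            * ((d₀ : ℝ) * (w₀ * (v₀ 0 * v₀ 1)) * x ^ d₀ + (d₁ : ℝ) * (w₁ * (v₁ 0 * v₁ 1)) * x ^ d₁
              + (d₂ : ℝ) * (w₂ * (v₂ 0 * v₂ 1)) * x ^ d₂ + (d₃ : ℝ) * (w₃ * (v₃ 0 * v₃ 1)) * x ^ d₃) := by
      intro x
      have hA := x_mul_eval_derivative_fourNomial (w₀ * v₀ 0 ^ 2) (w₁ * v₁ 0 ^ 2) (w₂ * v₂ 0 ^ 2) (w₃ * v₃ 0 ^ 2) x d₀ d₁ d₂ d₃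
      have hU := x_mul_eval_derivative_fourNomial (w₀ * (v₀ 0 * v₀ 1)) (w₁ * (v₁ 0 * v₁ 1)) (w₂ * (v₂ 0 * v₂ 1)) (w₃ * (v₃ 0 * v₃ 1)) x
        d₀ d₁ d₂ d₃
      have hC := x_mul_eval_derivative_fourNomial (w₀ * v₀ 1 ^ 2) (w₁ * v₁ 1 ^ 2) (w₂ * v₂ 1 ^ 2) (w₃ * v₃ 1 ^ 2) x d₀ d₁ d₂ d₃
      rw [hπ, h𝔄, h𝔘, hℭ]
      simp only [derivative_sub, derivative_mul, derivative_pow, Nat.cast_ofNat, Nat.add_one_sub_one, pow_one, eval_add, eval_sub,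
        eval_mul, eval_pow, eval_C, eval_X]
      linear_combination (w₀ * v₀ 1 ^ 2 * x ^ d₀ + w₁ * v₁ 1 ^ 2 * x ^ d₁ + w₂ * v₂ 1 ^ 2 * x ^ d₂ + w₃ * v₃ 1 ^ 2 * x ^ d₃) * hA
        + (w₀ * v₀ 0 ^ 2 * x ^ d₀ + w₁ * v₁ 0 ^ 2 * x ^ d₁ + w₂ * v₂ 0 ^ 2 * x ^ d₂ + w₃ * v₃ 0 ^ 2 * x ^ d₃) * hC
        - 2 * (w₀ * (v₀ 0 * v₀ 1) * x ^ d₀ + w₁ * (v₁ 0 * v₁ 1) * x ^ d₁ + w₂ * (v₂ 0 * v₂ 1) * x ^ d₂ + w₃ * (v₃ 0 * v₃ 1) * x ^ d₃) * hU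
    -- the one-signed double fewnomial
    let wv : Fin 4 → ℝ := ![w₀, w₁, w₂, w₃]
    let mv : Fin 4 → ℝ := ![m₀, m₁, m₂, m₃]
    let dv : Fin 4 → ℕ := ![d₀, d₁, d₂, d₃]
    let vv : Fin 4 → (Fin 2 → ℝ) := ![v₀, v₁, v₂, v₃]
    refine card_posRoots_le_one_of_eulerForm (Finset.univ : Finset (Fin 4 × Fin 4)) (fun kl => dv kl.1 + dv kl.2)
      (fun kl => (1 / 2 : ℝ) * (wv kl.1 * wv kl.2)
        * (mv kl.1 * mv kl.2 + 2 * δ * (vv kl.1 0 * vv kl.2 1 - vv kl.1 1 * vv kl.2 0) ^ 2)) (2 * e) E ?_ ?_ hE0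
    · rintro ⟨k, l⟩ _
      have hwk : ∀ i : Fin 4, 0 ≤ wv i := by intro i; fin_cases i <;> assumption
      have hmk : ∀ i : Fin 4, mv i ≤ 0 := by intro i; fin_cases i <;> assumption
      have h1 : 0 ≤ mv k * mv l := mul_nonneg_of_nonpos_of_nonpos (hmk k) (hmk l)
      have h2 : 0 ≤ 2 * δ * (vv k 0 * vv l 1 - vv k 1 * vv l 0) ^ 2 := by positivity
      have h3 : 0 ≤ wv k * wv l := mul_nonneg (hwk k) (hwk l)
      positivity
    · intro x hx
      rw [hE, eval_add, eval_mul, eval_mul, eval_C, hπe, hτe]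
      simp only [eval_sub, eval_mul, eval_X, eval_C]
      rw [hπ'eval, hπeval, hτ'eval, hτeval, Fintype.sum_prod_type, Fin.sum_univ_four, Fin.sum_univ_four, Fin.sum_univ_four,
        Fin.sum_univ_four, Fin.sum_univ_four]
      simp only [wv, mv, dv, vv, Matrix.cons_val_zero, Matrix.cons_val_one, Matrix.head_cons, Matrix.cons_val_two, Matrix.tail_cons,
        Matrix.cons_val_three, hm₀d, hm₁d, hm₂d, hm₃d]
      push_cast
      ring
  -- (c) assemble with the curvature reduction
  have hπnn : ∀ x, 0 < x → 0 ≤ π.eval x := by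
    intro x hx
    have hπeval : π.eval x = (w₀ * x ^ d₀ * v₀ 0 ^ 2 + w₁ * x ^ d₁ * v₁ 0 ^ 2 + w₂ * x ^ d₂ * v₂ 0 ^ 2 + w₃ * x ^ d₃ * v₃ 0 ^ 2)
        * (w₀ * x ^ d₀ * v₀ 1 ^ 2 + w₁ * x ^ d₁ * v₁ 1 ^ 2 + w₂ * x ^ d₂ * v₂ 1 ^ 2 + w₃ * x ^ d₃ * v₃ 1 ^ 2)
        - (w₀ * x ^ d₀ * (v₀ 0 * v₀ 1) + w₁ * x ^ d₁ * (v₁ 0 * v₁ 1) + w₂ * x ^ d₂ * (v₂ 0 * v₂ 1) + w₃ * x ^ d₃ * (v₃ 0 * v₃ 1)) ^ 2 := by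
      rw [hπ, eval_sub, eval_mul, eval_pow, h𝔄, h𝔘, hℭ, eval_fourNomial, eval_fourNomial, eval_fourNomial]
      ring
    rw [hπeval]
    exact pairDet_nonneg d₀ d₁ d₂ d₃ v₀ v₁ v₂ v₃ w₀ w₁ w₂ w₃ x hw₀ hw₁ hw₂ hw₃ hx
  have hmain := card_posRoots_le_curvature_count δ e τ π
    (Matrix.det (((X : ℝ[X]) ^ e) • J.map Polynomial.C
        + (Polynomial.C w₀ * X ^ d₀) • (vecMulVec v₀ v₀).map Polynomial.C
        + (Polynomial.C w₁ * X ^ d₁) • (vecMulVec v₁ v₁).map Polynomial.C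
        + (Polynomial.C w₂ * X ^ d₂) • (vecMulVec v₂ v₂).map Polynomial.C
        + (Polynomial.C w₃ * X ^ d₃) • (vecMulVec v₃ v₃).map Polynomial.C))
    τe πe τee πee Φ 𝒦 E hδpos hπnn hdisc
    (fun x _ => by
      rw [eval_det_resolvent_form e d₀ d₁ d₂ d₃ J hJ, hτeval]
      have hπx : π.eval x = (w₀ * x ^ d₀ * v₀ 0 ^ 2 + w₁ * x ^ d₁ * v₁ 0 ^ 2 + w₂ * x ^ d₂ * v₂ 0 ^ 2 + w₃ * x ^ d₃ * v₃ 0 ^ 2)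
          * (w₀ * x ^ d₀ * v₀ 1 ^ 2 + w₁ * x ^ d₁ * v₁ 1 ^ 2 + w₂ * x ^ d₂ * v₂ 1 ^ 2 + w₃ * x ^ d₃ * v₃ 1 ^ 2)
          - (w₀ * x ^ d₀ * (v₀ 0 * v₀ 1) + w₁ * x ^ d₁ * (v₁ 0 * v₁ 1) + w₂ * x ^ d₂ * (v₂ 0 * v₂ 1) + w₃ * x ^ d₃ * (v₃ 0 * v₃ 1)) ^ 2 := by
        rw [hπ, eval_sub, eval_mul, eval_pow, h𝔄, h𝔘, hℭ, eval_fourNomial, eval_fourNomial, eval_fourNomial]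
        ring
      rw [hπx, hm₀d, hm₁d, hm₂d, hm₃d]
      ring)
    hτe hπe hτee hπee (by rw [hΦ]) h𝒦 (by rw [hE]) hgen hne
  omega

end Summit.ValiantsHypothesis.ValiantsHypothesis.Theorems.LacunarySymmetroidMatrixDescartes.Pivot.Resolvent
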